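import Summits.CriticalPhenomena.CardyFormulaZ2.Theorems.CardyMagicRigidityNestingRigidityNeckZ2SkeletonArms
import HarnessLib

/-!
# Crux `NestingRigidity`, line `pinch-resampling` (v4), stub S12: slots blocked by a node annulus

Crux `Summit.CriticalPhenomena.CardyFormulaZ2.Theses.CardyMagicRigidity.NestingRigidity`
(stmt-CriticalPhenomena-4835), line `pinch-resampling` v4, stub S12 `stub_neckHookupCoarseZ2 : NeckHookupCoarseZ2`.
Brick of the summation of the necklace bound `ZNodeAbsBoundChainA` (amended plan in the module docstring of
`…NestingRigidityGapEntropy`, worker W6a), sequel of `…NeckZ2SkeletonArms`: the COUNT of the arm slots of a cell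
`m` (annuli `zAnn (nodeCenter m) (R₀ 2^{Kz}) (R₀ 2^{K(z+1)} - 1)`) which meet the annulus of a node `[i, j]`
(`zAnn (nodeCenter i) (nodeRIn i j) (nodeROut G)`, `G = gapOutZ i j`) — the slots a conflicting node can block.

* §1 `card_le_of_dyadic` — pure arithmetic: natural numbers `z` with `R₀ 2^{K z} ≤ hi` and `lo ≤ R₀ 2^{K (z+1)}`
  (`lo > 0`) number at most `max 0 (log₂ (hi / lo) / K) + 2`.
* §2 `CellSkeleton.blocked_band` — a slot of `m` meeting the annulus of `[i, j]` satisfies these two inequalities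
  with `hi = ROut + D`, `lo = max (rIn - D) (D - ROut)`, `D = |c_m - c_Q|_∞` (two triangle inequalities).
* §3 `CellSkeleton.band_ratio_le` — for a node with `16 (Δ + 1) ≤ G` (`Δ = t j - t i`): `0 < lo` and
  `hi ≤ (G / (8 (Δ + 1)) + 1) · lo`, in the lineage case `i ≤ m ≤ j` (`D < (Δ + 1) ℓ`) as in the other case
  (`2 D ≥ ℓ G - 2ℓ + 1` by `cellSkeleton_isolation`, whence `hi ≤ 3 lo`).
* §4 `CellSkeleton.card_blockedSlots_le` (registered anchor `cellSkeleton_blocked_slots`): the number of slots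
  `z < Jz` of `m` blocked by the node is `≤ log₂ (G / (8 (Δ + 1)) + 1) / K + 2 = log₂ (ρ_Q / 8 + 1) / K + 2`
  (`ρ_Q = GapHierarchy.ratio`, through `gapOut_cast`, `span_cast`).

Not here (next): the double count over conflicts (`Σ_m #conflicts ≤ 2 #good`) and the probabilistic assembly.
-/

noncomputable section

namespace Summit.CriticalPhenomena.CardyFormulaZ2.Cruxes.NestingRigidity.PinchResampling

open MeasureTheory Set Literature.Probability.Percolation Literature.Probability.LatticeModels
open ZPinchLocality Finset
open NeckCoarseZ2

/-! ## §1 Dyadic counting -/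

/-- **Dyadic counting**: the naturals `z` with `R₀ 2^{K z} ≤ hi` and `lo ≤ R₀ 2^{K (z + 1)}` (`lo > 0`, `K ≥ 1`) are
at most `max 0 (log₂ (hi / lo) / K) + 2` in number. -/
theorem card_le_of_dyadic {R₀ K : ℕ} (hK : 1 ≤ K) {lo hi : ℝ} (hlo : 0 < lo) (B : Finset ℕ)
    (hB : ∀ z ∈ B, (R₀ : ℝ) * 2 ^ (K * z) ≤ hi ∧ lo ≤ (R₀ : ℝ) * 2 ^ (K * (z + 1))) :
    (B.card : ℝ) ≤ max 0 (Real.logb 2 (hi / lo) / K) + 2 := by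
  rcases B.eq_empty_or_nonempty with rfl | hne
  · simp only [Finset.card_empty, Nat.cast_zero]
    positivity
  set z₁ := B.min' hne with hz₁
  have hz₁B : z₁ ∈ B := B.min'_mem hne
  have hK0 : (0 : ℝ) < K := by exact_mod_cast hK
  -- every element is at most `z₁ + 1 + log₂ (hi/lo) / K`
  have hbound : ∀ z ∈ B, (z : ℝ) ≤ z₁ + 1 + max 0 (Real.logb 2 (hi / lo) / K) := by
    intro z hz
    have hzz : z₁ ≤ z := B.min'_le z hz
    obtain ⟨hhi, -⟩ := hB z hz
    obtain ⟨-, hlo'⟩ := hB z₁ hz₁B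
    by_cases hle : z ≤ z₁ + 1
    · have : (z : ℝ) ≤ z₁ + 1 := by exact_mod_cast hle
      linarith [le_max_left 0 (Real.logb 2 (hi / lo) / K)]
    · -- `2^{K (z - z₁ - 1)} ≤ hi / lo`
      have hR₀ : (0 : ℝ) < R₀ := by
        by_contra h
        have h0 : (R₀ : ℝ) ≤ 0 := not_lt.1 h
        have : (R₀ : ℝ) * 2 ^ (K * (z₁ + 1)) ≤ 0 := mul_nonpos_of_nonpos_of_nonneg h0 (by positivity)
        linarith
      have hhi0 : 0 < hi := lt_of_lt_of_le (by positivity) hhi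
      have key : (2 : ℝ) ^ ((K : ℝ) * ((z : ℝ) - z₁ - 1)) ≤ hi / lo := by
        have h1 : (2 : ℝ) ^ ((K : ℝ) * ((z : ℝ) - z₁ - 1)) * ((R₀ : ℝ) * 2 ^ (K * (z₁ + 1))) =
            (R₀ : ℝ) * 2 ^ (K * z) := by
          have e : (K : ℝ) * ((z : ℝ) - z₁ - 1) + (K * (z₁ + 1) : ℕ) = (K * z : ℕ) := by push_cast; ring
          rw [mul_left_comm, ← Real.rpow_natCast 2 (K * (z₁ + 1)), ← Real.rpow_add (by norm_num), e,
            Real.rpow_natCast]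
        rw [le_div_iff₀ hlo]
        calc (2 : ℝ) ^ ((K : ℝ) * ((z : ℝ) - z₁ - 1)) * lo
            ≤ (2 : ℝ) ^ ((K : ℝ) * ((z : ℝ) - z₁ - 1)) * ((R₀ : ℝ) * 2 ^ (K * (z₁ + 1))) :=
              mul_le_mul_of_nonneg_left hlo' (by positivity)
          _ = (R₀ : ℝ) * 2 ^ (K * z) := h1
          _ ≤ hi := hhi
      have hlog : (K : ℝ) * ((z : ℝ) - z₁ - 1) ≤ Real.logb 2 (hi / lo) :=
        (Real.le_logb_iff_rpow_le (by norm_num) (by positivity)).2 key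
      have : (z : ℝ) - z₁ - 1 ≤ Real.logb 2 (hi / lo) / K := by
        rw [le_div_iff₀ hK0]; linarith
      linarith [le_max_right 0 (Real.logb 2 (hi / lo) / K)]
  -- hence `B ⊆ [z₁, z₁ + 1 + ⌊·⌋]`
  set W := ⌊max 0 (Real.logb 2 (hi / lo) / K)⌋₊ with hW
  have hW0 : 0 ≤ max 0 (Real.logb 2 (hi / lo) / K) := le_max_left _ _
  have hsub : B ⊆ Finset.Icc z₁ (z₁ + 1 + W) := fun z hz ↦ by
    rw [Finset.mem_Icc]
    refine ⟨B.min'_le z hz, ?_⟩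
    have h := hbound z hz
    have hlt := Nat.lt_floor_add_one (max 0 (Real.logb 2 (hi / lo) / K))
    have : (z : ℝ) < z₁ + 1 + W + 1 := by rw [hW]; linarith
    exact_mod_cast Nat.lt_succ_iff.1 (by exact_mod_cast this)
  calc (B.card : ℝ) ≤ ((Finset.Icc z₁ (z₁ + 1 + W)).card : ℝ) := by exact_mod_cast Finset.card_le_card hsub
    _ = W + 2 := by rw [Nat.card_Icc, show z₁ + 1 + W + 1 - z₁ = W + 2 by omega]; push_cast; ring
    _ ≤ max 0 (Real.logb 2 (hi / lo) / K) + 2 := by linarith [Nat.floor_le hW0]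

namespace NeckCoarseZ2.CellSkeleton

variable {Nc : ℤ} (S : CellSkeleton Nc)

/-! ## §2 The band of a node annulus seen from a cell -/

/-- **The band**: a slot of the cell `m` meeting the annulus `zAnn c_Q rIn ROut` satisfies
`armRIn z ≤ ROut + D` and `max (rIn - D) (D - ROut) ≤ armROut z`, `D = |c_m - c_Q|_∞`. -/
theorem blocked_band {cm cQ : Site 2} {rIn ROut R₀ K z : ℕ}
    (h : ¬ Disjoint (zAnn cm (Necklace.armRIn R₀ K z) (Necklace.armROut R₀ K z)) (zAnn cQ rIn ROut)) :
    (Necklace.armRIn R₀ K z : ℤ) ≤ ROut + zNorm (cm - cQ) ∧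
      max ((rIn : ℤ) - zNorm (cm - cQ)) (zNorm (cm - cQ) - ROut) ≤ Necklace.armROut R₀ K z := by
  rw [Set.not_disjoint_iff] at h
  obtain ⟨y, ⟨hy1, hy2⟩, hy1', hy2'⟩ := h
  have h1 := zNorm_sub_le_add y cQ cm
  have h2 := zNorm_sub_le_add y cm cQ
  have h3 := zNorm_sub_le_add cm y cQ
  rw [zNorm_sub_comm cQ cm] at h1
  rw [zNorm_sub_comm cm y] at h3
  refine ⟨by omega, max_le (by omega) (by omega)⟩

/-! ## §3 The band ratio of a good node -/

variable {ℓ s : ℕ} {x : Site 2}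

/-- **The band ratio**: for a node `[i, j]` with `16 (Δ + 1) ≤ G` and any cell `m < n`, with
`D = |c_m - c_Q|_∞`, `hi = ROut + D`, `lo = max (rIn - D) (D - ROut)`: `0 < lo` and `hi ≤ (G / (8 (Δ + 1)) + 1) lo`. -/
theorem band_ratio_le (hℓ : 1 ≤ ℓ) (hNc : 8 * ((s : ℤ) + 1) ≤ Nc * ℓ) (hNc' : (Nc - 1) * (ℓ : ℤ) < 8 * ((s : ℤ) + 1))
    (Groot : ℤ) {i j m : ℕ} (hij : i ≤ j) (hj : j < S.n) (hm : m < S.n)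
    (hgood : 16 * (S.t j - S.t i + 1) ≤ S.gapOutZ Groot i j) :
    let D : ℤ := zNorm (S.nodeCenter ((s : ℤ) + 1) ℓ x m - S.nodeCenter ((s : ℤ) + 1) ℓ x i)
    let hi : ℝ := (nodeROut ℓ (S.gapOutZ Groot i j) : ℝ) + D
    let lo : ℝ := max ((S.nodeRIn ℓ i j : ℝ) - D) ((D : ℝ) - nodeROut ℓ (S.gapOutZ Groot i j))
    0 < lo ∧ hi ≤ ((S.gapOutZ Groot i j : ℝ) / (8 * ((S.t j - S.t i : ℝ) + 1)) + 1) * lo := by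
  intro D hi lo
  rw [show ((S.t j : ℝ) - (S.t i : ℝ)) = ((S.t j - S.t i : ℤ) : ℝ) by push_cast; ring]
  have hℓ0 : (0 : ℤ) < ℓ := by exact_mod_cast hℓ
  have hR : (1 : ℤ) ≤ (s : ℤ) + 1 := by omega
  set G := S.gapOutZ Groot i j with hGdef
  set Δ := S.t j - S.t i with hΔdef
  have hi' : i < S.n := by omega
  have hΔ0 : 0 ≤ Δ := by have := S.t_mono hij hj; omega
  have hG0 : 0 ≤ G := by nlinarith
  -- casts of the radii
  have hrIn : ((S.nodeRIn ℓ i j : ℕ) : ℤ) = (2 * Δ + 3) * ℓ := by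
    simp only [nodeRIn]; push_cast; rw [Int.toNat_of_nonneg hΔ0]
  have hrOut : ((nodeROut ℓ G : ℕ) : ℤ) = ℓ * (G / 8) := by
    simp only [nodeROut]; push_cast; rw [Int.toNat_of_nonneg (Int.ediv_nonneg hG0 (by norm_num))]
  have hrOut8 : (ℓ : ℤ) * (G / 8) * 8 ≤ ℓ * G := by
    have h1 := Int.ediv_mul_le G (show (8 : ℤ) ≠ 0 by norm_num)
    nlinarith
  have hrOut0 : 0 ≤ (ℓ : ℤ) * (G / 8) := mul_nonneg hℓ0.le (Int.ediv_nonneg hG0 (by norm_num))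
  -- the centres are ring points of rotated cells `t m`, `t i`
  have hcm := zNorm_idxPt hℓ0 hNc' S.a₀_nonneg S.a₀_lt (S.t_nonneg hm) (S.t_lt m hm) (R := (s : ℤ) + 1)
  have hρm := rotIdx_cellIdx_idxPt hℓ0 hNc' S.a₀_nonneg S.a₀_lt (S.t_nonneg hm) (S.t_lt m hm) (R := (s : ℤ) + 1)
  have hDdef : D = zNorm (idxPt ((s : ℤ) + 1) (ℓ : ℤ) Nc S.a₀ (S.t m) - idxPt ((s : ℤ) + 1) (ℓ : ℤ) Nc S.a₀ (S.t i)) := by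
    show zNorm (S.nodeCenter ((s : ℤ) + 1) ℓ x m - S.nodeCenter ((s : ℤ) + 1) ℓ x i) = _
    simp only [nodeCenter, add_sub_add_left_eq_sub]
  -- real versions
  have hℓR : (0 : ℝ) < ℓ := by exact_mod_cast hℓ0
  have hΔR : (0 : ℝ) ≤ (Δ : ℝ) := by exact_mod_cast hΔ0
  have hGR : 16 * ((Δ : ℝ) + 1) ≤ (G : ℝ) := by exact_mod_cast hgood
  have hrInR : ((S.nodeRIn ℓ i j : ℕ) : ℝ) = (2 * (Δ : ℝ) + 3) * ℓ := by exact_mod_cast hrIn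
  set Rout : ℤ := ℓ * (G / 8) with hRoutdef
  have hrOutR : ((nodeROut ℓ G : ℕ) : ℝ) = (Rout : ℝ) := by exact_mod_cast hrOut
  have hRout8R : (Rout : ℝ) * 8 ≤ (ℓ : ℝ) * G := by exact_mod_cast hrOut8
  have hRout0R : (0 : ℝ) ≤ Rout := by exact_mod_cast hrOut0
  have hhi : hi = (Rout : ℝ) + D := by show ((nodeROut ℓ G : ℕ) : ℝ) + D = _; rw [hrOutR]
  have hlo : lo = max ((2 * (Δ : ℝ) + 3) * ℓ - D) ((D : ℝ) - Rout) := by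
    show max (((S.nodeRIn ℓ i j : ℕ) : ℝ) - D) ((D : ℝ) - (nodeROut ℓ G : ℕ)) = _
    rw [hrInR, hrOutR]
  have hρ0 : 0 ≤ (G : ℝ) / (8 * ((Δ : ℝ) + 1)) := by positivity
  rw [hhi, hlo]
  by_cases hlin : i ≤ m ∧ m ≤ j
  · -- lineage: `D < (Δ + 1) ℓ`
    have hD := S.zNorm_sub_center_lt hℓ0 hR hNc hNc' hcm hlin.1 hlin.2 hj hρm
    rw [← hDdef] at hD
    have hDR : (D : ℝ) < ((Δ : ℝ) + 1) * ℓ := by exact_mod_cast hD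
    have hlo1 : ((Δ : ℝ) + 2) * ℓ < (2 * (Δ : ℝ) + 3) * ℓ - D := by nlinarith
    have hlo0 : 0 < (2 * (Δ : ℝ) + 3) * ℓ - D := by nlinarith
    refine ⟨lt_max_of_lt_left hlo0, ?_⟩
    calc (Rout : ℝ) + D ≤ (ℓ : ℝ) * G / 8 + ((Δ : ℝ) + 1) * ℓ := by linarith
      _ ≤ ((G : ℝ) / (8 * ((Δ : ℝ) + 1)) + 1) * (((Δ : ℝ) + 2) * ℓ) := by
          have hq : (G : ℝ) / (8 * ((Δ : ℝ) + 1)) * (((Δ : ℝ) + 2) * ℓ) =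
              (G : ℝ) * (((Δ : ℝ) + 2) * ℓ) / (8 * ((Δ : ℝ) + 1)) := by ring
          have : (ℓ : ℝ) * G / 8 ≤ (G : ℝ) * (((Δ : ℝ) + 2) * ℓ) / (8 * ((Δ : ℝ) + 1)) := by
            rw [div_le_div_iff₀ (by norm_num) (by positivity)]
            have hGR0 : (0 : ℝ) ≤ (G : ℝ) := by exact_mod_cast hG0
            nlinarith
          nlinarith
      _ ≤ ((G : ℝ) / (8 * ((Δ : ℝ) + 1)) + 1) * max ((2 * (Δ : ℝ) + 3) * ℓ - D) ((D : ℝ) - Rout) :=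
          mul_le_mul_of_nonneg_left (hlo1.le.trans (le_max_left _ _)) (by positivity)
  · -- non-lineage: `2 D ≥ ℓ G - 2ℓ + 1`, the band has ratio `≤ 3`
    have hout : m < i ∨ j < m := by omega
    have hroot : ¬ (i = 0 ∧ j = S.n - 1) := fun h ↦ by rcases hout with h' | h' <;> omega
    have hD := S.le_two_mul_zNorm_sub_center Groot hℓ0 hR hNc hNc' hcm hij (by omega) hroot hm hout hρm
    rw [← hDdef] at hD
    have hDR : (ℓ : ℝ) * G - 2 * ℓ + 1 ≤ 2 * (D : ℝ) := by exact_mod_cast hD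
    have hDℓ : 7 * (ℓ : ℝ) ≤ D := by nlinarith
    have hRoutD : 4 * (Rout : ℝ) ≤ (D : ℝ) + ℓ := by nlinarith
    have hlo0 : 0 < (D : ℝ) - Rout := by nlinarith
    refine ⟨lt_max_of_lt_right hlo0, ?_⟩
    have h3 : (Rout : ℝ) + D ≤ 3 * ((D : ℝ) - Rout) := by nlinarith
    have hρ2 : (3 : ℝ) ≤ (G : ℝ) / (8 * ((Δ : ℝ) + 1)) + 1 := by
      have : (2 : ℝ) ≤ (G : ℝ) / (8 * ((Δ : ℝ) + 1)) := by
        rw [le_div_iff₀ (by positivity)]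
        linarith
      linarith
    calc (Rout : ℝ) + D ≤ 3 * ((D : ℝ) - Rout) := h3
      _ ≤ ((G : ℝ) / (8 * ((Δ : ℝ) + 1)) + 1) * ((D : ℝ) - Rout) := mul_le_mul_of_nonneg_right hρ2 hlo0.le
      _ ≤ ((G : ℝ) / (8 * ((Δ : ℝ) + 1)) + 1) * max ((2 * (Δ : ℝ) + 3) * ℓ - D) ((D : ℝ) - Rout) :=
          mul_le_mul_of_nonneg_left (le_max_right _ _) (by positivity)

/-! ## §4 The number of blocked slots -/

open scoped Classical in
/-- **The slots of the cell `m` blocked by the node `[i, j]`** (those whose annulus meets the node annulus). -/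
def blockedSlots (ℓ : ℕ) (x : Site 2) (R : ℤ) (R₀ K Jz : ℕ) (Groot : ℤ) (m i j : ℕ) : Finset ℕ :=
  (range Jz).filter fun z ↦ ¬ Disjoint
    (zAnn (S.nodeCenter R ℓ x m) (Necklace.armRIn R₀ K z) (Necklace.armROut R₀ K z))
    (zAnn (S.nodeCenter R ℓ x i) (S.nodeRIn ℓ i j) (nodeROut ℓ (S.gapOutZ Groot i j)))

open scoped Classical in
/-- **A good node blocks at most `log₂ (ρ/8 + 1) / K + 2` slots of any cell**, `ρ = G / (Δ + 1)`. -/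
theorem card_blockedSlots_le (hℓ : 1 ≤ ℓ) (hNc : 8 * ((s : ℤ) + 1) ≤ Nc * ℓ)
    (hNc' : (Nc - 1) * (ℓ : ℤ) < 8 * ((s : ℤ) + 1)) (Groot : ℤ) {R₀ K Jz : ℕ} (hK : 1 ≤ K)
    {i j m : ℕ} (hij : i ≤ j) (hj : j < S.n) (hm : m < S.n) (hgood : 16 * (S.t j - S.t i + 1) ≤ S.gapOutZ Groot i j) :
    ((S.blockedSlots ℓ x ((s : ℤ) + 1) R₀ K Jz Groot m i j).card : ℝ) ≤
      Real.logb 2 ((S.gapOutZ Groot i j : ℝ) / (8 * ((S.t j - S.t i : ℝ) + 1)) + 1) / K + 2 := by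
  obtain ⟨hlo, hratio⟩ := S.band_ratio_le hℓ hNc hNc' Groot hij hj hm hgood (x := x)
  set D : ℤ := zNorm (S.nodeCenter ((s : ℤ) + 1) ℓ x m - S.nodeCenter ((s : ℤ) + 1) ℓ x i) with hD
  set hi : ℝ := (nodeROut ℓ (S.gapOutZ Groot i j) : ℝ) + D
  set lo : ℝ := max ((S.nodeRIn ℓ i j : ℝ) - D) ((D : ℝ) - nodeROut ℓ (S.gapOutZ Groot i j))
  set ρ' : ℝ := (S.gapOutZ Groot i j : ℝ) / (8 * ((S.t j - S.t i : ℝ) + 1)) + 1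
  have hΔ0 : (0 : ℝ) ≤ (S.t j - S.t i : ℝ) := by
    have := S.t_mono hij hj
    have : (0 : ℤ) ≤ S.t j - S.t i := by omega
    exact_mod_cast this
  have hG0 : (0 : ℝ) ≤ (S.gapOutZ Groot i j : ℝ) := by
    have : (0 : ℤ) ≤ S.gapOutZ Groot i j := by nlinarith [S.t_mono hij hj]
    exact_mod_cast this
  have hρ1 : 1 ≤ ρ' := by
    have : 0 ≤ (S.gapOutZ Groot i j : ℝ) / (8 * ((S.t j - S.t i : ℝ) + 1)) := by positivity
    linarith
  -- the two dyadic inequalities of a blocked slot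
  have hB : ∀ z ∈ S.blockedSlots ℓ x ((s : ℤ) + 1) R₀ K Jz Groot m i j,
      (R₀ : ℝ) * 2 ^ (K * z) ≤ hi ∧ lo ≤ (R₀ : ℝ) * 2 ^ (K * (z + 1)) := by
    intro z hz
    simp only [blockedSlots, mem_filter] at hz
    obtain ⟨h1, h2⟩ := blocked_band hz.2
    have h1' : ((Necklace.armRIn R₀ K z : ℕ) : ℝ) ≤ hi := by
      have : ((Necklace.armRIn R₀ K z : ℕ) : ℝ) ≤ ((nodeROut ℓ (S.gapOutZ Groot i j) : ℕ) : ℝ) + (D : ℝ) := by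
        exact_mod_cast h1
      exact this
    have h2' : lo ≤ ((Necklace.armROut R₀ K z : ℕ) : ℝ) := by
      have : max (((S.nodeRIn ℓ i j : ℕ) : ℝ) - (D : ℝ)) ((D : ℝ) - ((nodeROut ℓ (S.gapOutZ Groot i j) : ℕ) : ℝ)) ≤
          ((Necklace.armROut R₀ K z : ℕ) : ℝ) := by
        have e := (Int.cast_max (R := ℝ) (a := (S.nodeRIn ℓ i j : ℤ) - D)
          (b := D - (nodeROut ℓ (S.gapOutZ Groot i j) : ℤ)))
        have h := (Int.cast_le (R := ℝ)).2 h2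
        rw [e] at h
        push_cast at h
        exact h
      exact this
    have hrin : ((Necklace.armRIn R₀ K z : ℕ) : ℝ) = (R₀ : ℝ) * 2 ^ (K * z) := by
      simp [Necklace.armRIn]
    have hrout : ((Necklace.armROut R₀ K z : ℕ) : ℝ) ≤ (R₀ : ℝ) * 2 ^ (K * (z + 1)) := by
      have : Necklace.armROut R₀ K z ≤ R₀ * 2 ^ (K * (z + 1)) := Nat.sub_le _ _
      exact_mod_cast this
    exact ⟨hrin ▸ h1', h2'.trans hrout⟩
  have hcard := card_le_of_dyadic hK hlo _ hB
  -- `log₂ (hi / lo) ≤ log₂ ρ'` and `0 ≤ log₂ ρ'`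
  have hlogρ : 0 ≤ Real.logb 2 ρ' := Real.logb_nonneg (by norm_num) hρ1
  have hhi0 : 0 ≤ hi := by
    have : (0 : ℝ) ≤ (D : ℝ) := by exact_mod_cast zNorm_nonneg _
    positivity
  have hlog : Real.logb 2 (hi / lo) ≤ Real.logb 2 ρ' := by
    rcases hhi0.eq_or_lt with h | h
    · rw [← h, zero_div, Real.logb_zero]
      exact hlogρ
    · exact Real.logb_le_logb_of_le (by norm_num) (by positivity) (by rw [div_le_iff₀ hlo]; exact hratio)
  have hK0 : (0 : ℝ) < K := by exact_mod_cast hK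
  have hmax : max 0 (Real.logb 2 (hi / lo) / K) ≤ Real.logb 2 ρ' / K :=
    max_le (by positivity) (div_le_div_of_nonneg_right hlog hK0.le)
  linarith

end NeckCoarseZ2.CellSkeleton

open scoped Classical in
/-- **A good node blocks few arm slots (registered helper, anchor of this module on the crux item)**: for a cell
skeleton of the ring (`(Nc - 1) ℓ < 8 (s + 1) ≤ Nc ℓ`), a node `[i, j]` with `16 (t j - t i + 1) ≤ G = gapOutZ i j`
and any cell `m < n`, the slots `z < Jz` of `m` whose annulus meets the node annulus are at most
`log₂ (G / (8 (t j - t i + 1)) + 1) / K + 2` (`CellSkeleton.card_blockedSlots_le`). -/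
theorem cellSkeleton_blocked_slots : ∀ (ℓ s : ℕ) (x : Site 2) (Nc : ℤ) (S : NeckCoarseZ2.CellSkeleton Nc) (Groot : ℤ) (R₀ K Jz i j m : ℕ), 1 ≤ ℓ → 8 * ((s : ℤ) + 1) ≤ Nc * ℓ → (Nc - 1) * (ℓ : ℤ) < 8 * ((s : ℤ) + 1) → 1 ≤ K → i ≤ j → j < S.n → m < S.n → 16 * (S.t j - S.t i + 1) ≤ S.gapOutZ Groot i j → ((S.blockedSlots ℓ x ((s : ℤ) + 1) R₀ K Jz Groot m i j).card : ℝ) ≤ Real.logb 2 ((S.gapOutZ Groot i j : ℝ) / (8 * ((S.t j - S.t i : ℝ) + 1)) + 1) / K + 2 :=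
  fun _ _ _ _ S Groot _ _ _ _ _ _ hℓ hNc hNc' hK hij hj hm hgood ↦ S.card_blockedSlots_le hℓ hNc hNc' Groot hK hij hj hm hgood

end Summit.CriticalPhenomena.CardyFormulaZ2.Cruxes.NestingRigidity.PinchResampling

end
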